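import Literature.MathematicalPhysics.QuantumFieldTheory.Balaban1983to89.T3MinimiserStabilityReduction
import Literature.MathematicalPhysics.QuantumFieldTheory.Balaban1983to89.T3PrintedRegularMinimiser
import Literature.MathematicalPhysics.QuantumFieldTheory.Balaban1983to89.T3OrbitAverage
import Literature.MathematicalPhysics.QuantumFieldTheory.Balaban1983to89.B12ContinuousTransportInvariance
import Literature.MathematicalPhysics.QuantumFieldTheory.Balaban1983to89.Node00.CanonicalTransportOfRecord
import HarnessLib

/-!
# LINE g20-1 · «VIRIAL FLOW FOR H4ᶜ» — v1.1 (ideator seat ym-r3-idea-1, generation g20; lens «control»)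

Crux of record: `stmt-QuantumFields-20520` (`UnitScaleTilt.FluctuationComparisonRegPrIntL`); package of record
`Cruxes/FluctuationComparisonRegPrIntL/Lines/runpair_organ.lean` (v15), registered input **S2β `FluctuationPartSmall`** via LINE g18-1
`Lines/semiclassical_s2beta.lean` v10.1 (composition 1L4ᶜ → H4ᶜ → LFR♯ᶜ → S2β PROVED there).  TARGET OF THIS LINE = the organ **H4ᶜ `BeyondOneLoopSmallCan`** (XL),
restated VERBATIM in §0 with everything it mentions (`heightDensityCan`, `fourPt`, `fluctAtCan`, `oneLoopFourPtCan`; token-identical to LINE g19-2 `Lines/loop_ledger.lean`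
v6 §0a/§0c and LINE g18-1 v10.1 §1/§2); closure is BY TEXT (the farm cannot import `Cruxes/…/Lines/*.lean`).  The OTHER line on H4ᶜ is LINE g19-2 («loop ledger»: organ REP =
one small V-local polymer representation of the beyond-one-loop part in IDENTITY form); this line is a DIFFERENT MECHANISM for the same organ and shares no stub with it.

THE CONTROL TABLE (lens «control»).  CONTROLLING QUANTITY = **THE FLOW** `𝔣^λ(V) := λ·∂_λ f^λ(V)` of the λ-scaled fluctuation part along the semiclassical deformation
`λ ∈ [1, ∞)` (coupling `γ/λ`, lattices and history windows FIXED) — in print's variables MINUS THE EQUIPARTITION DEFECT of the constrained fluctuation measure over the fibre of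
`V`: `𝔣^λ(V) = −(⟨λβ_K·(A − A_min(V))⟩_{V,λ} − d′/2) + C(λ)` (`C(λ)`, `d′` datum-independent: the normalising partition function and half the number of transversal modes).
Two facts make it the right currency for H4ᶜ:
* **THE ONE-LOOP PART IS THE BOUNDARY TERM AT `λ = ∞`, NEVER SUBTRACTED BY HAND.**  By the fundamental theorem of calculus on `[1, ∞)` — Kirkwood's coupling-constant
  integration / the lattice «action sum rule» `∂_β log Z = −⟨A⟩` ([Michael1987] NPB 280; [Creutz1983] ch. 9) — `fourPt f¹ − Λ₄ = −∫_1^∞ fourPt(𝔣^λ) dλ/λ`, where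
  `Λ₄ := oneLoopFourPtCan = lim_λ fourPt f^λ` is H4ᶜ's own DEFINED one-loop 4-point (a `limUnder`).  PROVED here (§3, Mathlib's `integral_Ioi_of_hasDerivAt_of_tendsto'`),
  INCLUDING the existence of the limit `Λ₄` (`tendsto_limUnder_of_hasDerivAt_of_integrableOn_Ioi`: an integrable derivative forces convergence) — so this line needs
  NEITHER SCL nor EXW/GAP♯ as hypotheses (they re-enter only inside the organ's proof: conserved wall, counted once, said below).
* **AT ONE LOOP THE FLOW IS A UNIVERSAL CONSTANT (equipartition).**  For any Gaussian `⟨λβ·Q⟩ = ½·rank Q` whatever the covariance: the one-loop part of `𝔣^λ(V)` is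
  `−d′/2`, INDEPENDENT OF THE DATUM, so the connected 4-point `fourPt(𝔣^λ)` has NO one-loop term identically — the beyond-one-loop smallness is EXPLICIT: by the
  virial / Euler identity `⟨S⟩ − d′/2 = −Σ_{n≥3} (n/2 − 1)⟨S_n⟩` (integration by parts against the dilation field; `S_n` = degree-`n` Taylor term of the constrained action
  at the minimiser, `S_n = O(g_λ^{n−2})`, `g_λ² = γ/(λ L^J)`), the defect is `O(g_J²/λ)` per unit volume ([Balaban1985UV3] (36)–(37): the terms beyond the Gaussian
  approximation of one fluctuation integral carry `g²`; lattice perturbation theory of the mean plaquette `⟨1 − Re tr U_p⟩ = d′/(2β)·(1 + O(1/β))`).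

THE TABLE: **DIFF `FluctDifferentiableCan`** (stub, S/M, hand-ready): on the window, `λ ↦ f^λ(V)` is differentiable on `[1, ∞)` (dominated differentiation of the explicit
fibre integral of `1_hist·e^{−λβA}` that represents the canonical version on the window — the closed WREG table of LINE g18-2, at coupling `γ/λ` on the FIXED `γ`-window).
**FMIX `FlowFourPtDecayCan`** (organ stub, XL): same prefix as H4ᶜ; the connected 4-point of the FLOW under the four one-bond window moves is κ-clustered with an
INTEGRABLE λ-TAIL: `|fourPt(𝔣^λ)(U,V,W,Z)| ≤ Φ J · λ^{−η} · e^{−κ·tdist(b,b′)}` for `λ ≥ 1`, `∃ η > 0`, `J·Φ J → 0`, depth-uniform.  **PROVED**: `beyondOneLoopSmallCan_of_flow :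
FluctDifferentiableCan → FlowFourPtDecayCan → BeyondOneLoopSmallCan` with `φ₂ J := Φ J / η` (`∫_1^∞ λ^{−1−η} dλ = 1/η`, `integral_Ioi_rpow_of_lt`), and the corollary
`oneLoopFourPt_tendsto_of_flow` (FMIX ∧ DIFF ⇒ the one-loop 4-point limit EXISTS on window quadruples — 1L4ᶜ's clause (T) — CARRIED INSIDE FMIX, not «for free»:
WALL SENTENCE (critic #375 P2): FMIX ⊇ H4ᶜ at EVERY base point λ₀ ≥ 1 AND 1L4ᶜ's (T) for window quadruples; its λ-uniform clustering is Bałaban's multi-step control of the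
constrained fluctuation measure at couplings γ/λ ≤ γ (REP's wall) PLUS the 4-point Laplace limit (LAPLACE/1L4ᶜ's wall) — both counted once, here).

WHY THIS CUT IS EASIER THAN REP/GAS (named tools), and why it is not the census's dead λ-lines.  (1) FMIX is an INEQUALITY for a GIBBS EXPECTATION (truncated 2- and 3-point
functions of local observables — `∂_b S`, `∂_{b′} S` and the extensive energy `λβ(A − A_min)` — under the constrained fluctuation measure at coupling `γ/λ ≤ γ`), not an
IDENTITY for a LOGARITHM with STRICTLY V-local activities: LOCATE-GAS1-REP §2b's obstruction (the Gaussian data at the datum — minimiser, covariance `(H_U + D_UD_U^*)⁻¹`,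
vertices — are global in `U` with exponential tails, so identity formats need a forest formula / finite-range cascade the tree lacks) is ABSENT: exponentially localised data
compose under inequalities by telescoping (tools: ✓`coercive_combes_thomas_real` (D1) for the covariance, ✓`Literature.Analysis.Matrix.LogDetMixedDifferenceLocallySummed`,
tree-graph bounds ✓`Literature.Probability.LatticeModels.{ClusterExpansion, PolymerTreeSum, BattleFederbushTrees}`; at depth one the tree's PROVED engine
✓`…LocalPerturbationObservables` / `…LocalPerturbationClusterExpansion.pertLogZ_eq_sum_truncatedWeight` after the Neumann finite-range pieces ✓-typed in `NeumannFRDSketch.lean`).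
(2) No one-loop/beyond split inside the organ (equipartition kills the one-loop term of the flow identically; REP must deliver `f¹ − c − F₀` in identity form, i.e. the exact
cancellation of the classical AND one-loop parts at every depth).  (3) The coupling only DECREASES along the deformation (`γ/λ ≤ γ`): every expansion that converges at `λ = 1`
converges uniformly on `[1,∞)`, and the λ-decay asked is `∃ η > 0` (print: `η = 1`), not a rate at a hand-picked exponent (typing checklist 4c (iv)).  Census: #147 (dyadic
ℏ-ladder, RESERVE «only if a per-rung estimate with geometric decay is located») — the equipartition/virial identity IS that estimate (rung `λ ∈ [2^n, 2^{n+1}]` weighs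
`2^{−ηn}`); #153/#154 (λ-uniform polymer representation / λ-uniform increments of `f^λ − F₀`: variants of SFN «with a λ attached», identity formats, `∃ F₀`-sharing) — here no
representation, no `F₀` inside the organ, the object is the defect EXPECTATION; #146/#128 (cone II: covariance control by convexity / Brascamp–Lieb through the large-field
region) — not engaged: FMIX is proved by expansion in the small-field window at weak coupling (cone I, the class of REP), KP majorants allowed, no log-concavity.

Why it might fail (honest): (i) DIFF needs the canonical version AT COUPLING `γ/λ` identified with the explicit fibre integral on the FIXED `γ`-WINDOW for every `λ ≥ 1`
(WREG at a rescaled `b₀`; the package's `ε₀ ≤ ε₁(b₀,p₀)` regime may pinch).  TYPED PINCH-REPAIR (critic #375 P1, kernel e14): `flowCan` is `deriv`-junk `0` wherever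
`μ ↦ f^μ(V)` is not differentiable, so FMIX is contentful ONLY jointly with DIFF on the same λ-set and a truncated DIFF on `[1, λ_max]` is NOT a repair (FMIX would hold by
junk beyond `λ_max` and the FTC composition, which needs `HasDerivAt` on all of `Ici 1`, dies).  DIFF is therefore KEPT on `[1, ∞)` as typed; if the regime pinches, the
repair of record is the derivative-free OSCILLATION form FMIX′ replacing DIFF ∧ FMIX jointly: `∀ λ′ ≥ λ ≥ 1, |fourPt f^λ − fourPt f^{λ′}| ≤ Φ J·λ^{−η}·e^{−κ·tdist(b,b′)}`
(Cauchy in λ ⇒ the limit Λ₄ exists by completeness and `|fourPt f¹ − Λ₄| ≤ Φ J·e^{−κ·tdist}`, i.e. H4ᶜ with φ₂ := Φ, no derivative, no FTC); (ii) FMIX's depth-uniformity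
is the same wall as REP's (Bałaban's multi-step expansion of the fluctuation measure, [Balaban1985UV3] §A (25)–(37), [Balaban1987RG1] (0.13)–(0.26)) — CONSERVED AND COUNTED
ONCE: the organ is where the XL small-field work goes; what is removed is the identity/strict-locality/one-loop-subtraction dressing, not the expansion; (iii) the sharp
history windows make the Gaussian equipartition inexact by boundary terms `O(e^{−c p(g_J)²})` — datum-dependent but inside `Φ J`; (iv) `fourPt(𝔣^λ)` mixes the response of
the MEASURE (fibre moved at `b`, `b′`) and of the OBSERVABLE (`A_min(V)`), so the hand needs the fibre-translation change of variables of EXW's chart rows before expanding.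

v1.2 (critic #375 PASS-WITH-PRICE light: P1 pinch-repair typed, P2 wall sentence, N1/N2 notes — DOCSTRINGS ONLY, every statement token-identical to v1.1;
P3's sealed kill numbers are on the card `Lines/virial_flow.md`).  Sorries (v1.2, unchanged) = {DIFF `stub_fluctDifferentiableCan` (S/M, hand-ready: LAPLACE/WREG pens), FMIX `stub_flowFourPtDecayCan` (XL organ, this line's)}; 0 elsewhere.  No summit is
proved by a line; `YM3TorusSU2` is NOT proved (the package's other inputs S1a, 26243, S2α′, O1 and S2β's other organs EXW, GAP♯, LAPLACE/1L4ᶜ, LFRᶜ stay open); nothing of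
Bałaban's asserted; rung R3 (YM₃ on T³) — NOT d = 4, NOT infinite volume, NOT a mass gap, NOT Clay.
-/

noncomputable section

open MeasureTheory Filter Topology Set
open Literature.MathematicalPhysics.QuantumFieldTheory.Balaban1983to89
open Literature.MathematicalPhysics.QuantumFieldTheory.Balaban1983to89.T3ContinuumYM3Torus
open Literature.MathematicalPhysics.QuantumFieldTheory.Balaban1983to89.T3NestedUnitLaws
open Literature.MathematicalPhysics.QuantumFieldTheory.Balaban1983to89.T3UnitLawDensityEML
open Literature.MathematicalPhysics.QuantumFieldTheory.Balaban1983to89.T3UnitScaleTilt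
open Literature.MathematicalPhysics.QuantumFieldTheory.Balaban1983to89.T3TiltDescent
open Literature.MathematicalPhysics.QuantumFieldTheory.Balaban1983to89.T3PrintedRegularMinimiser
open Literature.MathematicalPhysics.QuantumFieldTheory.Balaban1983to89.T3ConstrainedMinimiser (fibre)
open Literature.MathematicalPhysics.QuantumFieldTheory.Balaban1983to89.T3LevelShift
open Literature.MathematicalPhysics.QuantumFieldTheory.Balaban1983to89.Missing
open Literature.MathematicalPhysics.QuantumFieldTheory.Balaban1983to89.T4Continuum

namespace Summit.QuantumFields.YangMills.Cruxes.FluctuationComparisonRegPrIntL.RunPairOrgan.VirialFlow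

/-! ## §0a The canonical version of the restricted height density (verbatim from LINE g19-2 `Lines/loop_ledger.lean` v6 §0a = LINE g18-1 v10.1 §1) -/

section Canonical

variable (F : T3Family) (γ : ℝ) {J K : ℕ} (hJK : J ≤ K) (S : Set (GaugeField (F.P K) 0 (Matrix.specialUnitaryGroup (Fin 2) ℂ)))

/-- **THE CANONICAL VERSION OF BAŁABAN'S RESTRICTED DENSITY AT HEIGHT `K − J`** read on the `J`-th tower's finest lattice: the trunk's `heightDensity`
(a chosen Radon–Nikodym version) replaced by `Node00.canonVersion` of its a.e.-class for product Haar — continuous on the maximal open set carrying a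
continuous representative and equal there to every such representative. [cite: Balaban1985UV3, (2) p.256 and (41) p.266] -/
def heightDensityCan (V : GaugeField (F.P J) 0 (Matrix.specialUnitaryGroup (Fin 2) ℂ)) : ℝ :=
  Node00.canonVersion (fieldMeasure (F.P J) 0 (Matrix.specialUnitaryGroup (Fin 2) ℂ)) (heightDensity F γ hJK S) V

end Canonical

/-! ## §0c The λ-scaled fluctuation part, the canonical one-loop 4-point and the TARGET organ H4ᶜ (verbatim from LINE g19-2 `Lines/loop_ledger.lean` v6 §0c = LINE g18-1 v10.1 §2) -/

section Rows

/-- The connected 4-point (mixed second difference) — verbatim from v3a. [cite: Balaban1985UV3, (41) p.266] -/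
def fourPt {X : Type*} (f : X → ℝ) (U V W Z : X) : ℝ := (f U - f V) - (f W - f Z)

variable (F : T3Family) (γ b₀ p₀ ε₀ : ℝ) {J K : ℕ} (hJK : J ≤ K)

/-- **THE λ-SCALED FLUCTUATION PART OVER THE CANONICAL VERSION** `f^λ(V) := log heightDensityCan F (γ/λ) (histGood at θBal(γ)) V + β_K(γ/λ)·minActionRegPr(V)`.
[cite: Balaban1985UV3, (2) p.256 and (41) p.266] -/
def fluctAtCan (lam : ℝ) (V : GaugeField (F.P J) 0 (Matrix.specialUnitaryGroup (Fin 2) ℂ)) : ℝ :=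
  Real.log (heightDensityCan F (γ / lam) hJK (histGood F ℰp (θBal F.L γ b₀ p₀) K J) V)
    + (F.scheme ℰp (γ / lam)).β K * minActionRegPr F J K hJK ε₀ V

/-- **THE CANONICAL ONE-LOOP 4-POINT** `Λ₄ := lim_{λ→∞} Δ² f^λ` over the canonical version (junk if the limit does not exist; 1L4ᶜ asserts it does).
[cite: Balaban1985Variational, Thm 1 (8)-(10) p.279] -/
def oneLoopFourPtCan (U V W Z : GaugeField (F.P J) 0 (Matrix.specialUnitaryGroup (Fin 2) ℂ)) : ℝ :=
  limUnder atTop (fun lam : ℝ => fourPt (fluctAtCan F γ b₀ p₀ ε₀ hJK lam) U V W Z)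

/-- At `λ = 1`: S2β's integrand with the canonical small-history density. [cite: Balaban1985UV3, (41) p.266] -/
theorem fluctAtCan_one (V : GaugeField (F.P J) 0 (Matrix.specialUnitaryGroup (Fin 2) ℂ)) :
    fluctAtCan F γ b₀ p₀ ε₀ hJK 1 V =
      Real.log (heightDensityCan F γ hJK (histGood F ℰp (θBal F.L γ b₀ p₀) K J) V)
        + (F.scheme ℰp γ).β K * minActionRegPr F J K hJK ε₀ V := by
  simp only [fluctAtCan, div_one]

/-- Whenever the λ-scaled 4-point has SOME limit `a`, the canonical one-loop 4-point equals it. [cite: Balaban1985Variational, Thm 1 (8) p.279] -/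
theorem oneLoopFourPtCan_eq_of_tendsto (U V W Z : GaugeField (F.P J) 0 (Matrix.specialUnitaryGroup (Fin 2) ℂ)) {a : ℝ}
    (h : Tendsto (fun lam : ℝ => fourPt (fluctAtCan F γ b₀ p₀ ε₀ hJK lam) U V W Z) atTop (𝓝 a)) :
    oneLoopFourPtCan F γ b₀ p₀ ε₀ hJK U V W Z = a := by
  unfold oneLoopFourPtCan; exact h.limUnder_eq


/-- **H4ᶜ · BEYOND ONE LOOP, OVER THE CANONICAL VERSION** (re-typing of v3a's `BeyondOneLoopSmall`): the `λ = 1` connected 4-point of `f^λ` differs from its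
semiclassical limit by a κ-clustered `≤ φ₂ J`, `J·φ₂ J → 0`, depth-uniform. [cite: Balaban1985UV3, (45)-(47) p.267; Balaban1987RG1, Thm 1 (0.19)-(0.26)] -/
def BeyondOneLoopSmallCan : Prop :=
  ∀ (L : ℕ), ∃ pS : ℝ, ∀ (b₀ p₀ : ℝ), 0 < b₀ → pS ≤ p₀ → 0 < p₀ → ∃ ε₁ : ℝ, 0 < ε₁ ∧ ∀ (ε₀ : ℝ), 0 < ε₀ → ε₀ ≤ ε₁ →
    ∃ γ₁ : ℝ, 0 < γ₁ ∧ ∃ κ : ℝ, 0 < κ ∧ ∀ (F : T3Family) (γ : ℝ), F.L = L → 0 < γ → γ ≤ γ₁ →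
      ∃ φ₂ : ℕ → ℝ, (∀ J, 0 ≤ φ₂ J) ∧ Tendsto (fun J : ℕ => (J : ℝ) * φ₂ J) atTop (𝓝 0) ∧
        ∀ (J K : ℕ) (hJK : J ≤ K) (b b' : PBond (F.P J) 0) (U V W Z : GaugeField (F.P J) 0 (Matrix.specialUnitaryGroup (Fin 2) ℂ)),
          PlaqSmall (θBal F.L γ b₀ p₀ J) U → PlaqSmall (θBal F.L γ b₀ p₀ J) V →
          PlaqSmall (θBal F.L γ b₀ p₀ J) W → PlaqSmall (θBal F.L γ b₀ p₀ J) Z →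
          (∀ e, e ≠ b → U e = V e) → (∀ e, e ≠ b' → U e = W e) → (∀ e, e ≠ b' → V e = Z e) → (∀ e, e ≠ b → W e = Z e) →
          |fourPt (fluctAtCan F γ b₀ p₀ ε₀ hJK 1) U V W Z - oneLoopFourPtCan F γ b₀ p₀ ε₀ hJK U V W Z|
            ≤ φ₂ J * Real.exp (-(κ * (b.src.tdist b'.src : ℝ)))

end Rows

/-! ## §1 THE NEW OBJECT: the flow `𝔣^λ = λ·∂_λ f^λ` (minus the equipartition defect), its calculus, measurability -/

section Flow

variable (F : T3Family) (γ b₀ p₀ ε₀ : ℝ) {J K : ℕ} (hJK : J ≤ K)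

/-- **THE FLOW OF THE λ-SCALED FLUCTUATION PART** `𝔣^λ(V) := λ · ∂_λ f^λ(V)` (Mathlib `deriv`; junk `0` where `λ ↦ f^λ(V)` is not differentiable — DIFF says it is on
the window for `λ ≥ 1`).  In print's variables, with `β = β_K(γ)` and `f^λ(V) = log ∫_{fibre(V) ∩ hist} e^{−λβ(A − A_min(V))} − log Z_λ`, the action sum rule gives
`𝔣^λ(V) = −⟨λβ(A − A_min(V))⟩_{V,λ} + λ∂_λ(−log Z_λ) = −(EQUIPARTITION DEFECT `⟨λβ(A − A_min)⟩ − d′/2`) + C(λ)` with `C(λ)`, `d′` datum-independent; at one loop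
(Gaussian fluctuation measure) the defect VANISHES identically (`⟨λβQ⟩ = ½ rank Q` for every covariance), so every connected difference of `𝔣^λ` in the datum is a
beyond-one-loop quantity, `O(g_J²/λ)` by the virial identity `⟨S⟩ − d′/2 = −Σ_{n≥3}(n/2 − 1)⟨S_n⟩`. [cite: Michael1987ActionSumRules, (2.3); Balaban1985UV3, (36)-(37) p.265] -/
def flowCan (lam : ℝ) (V : GaugeField (F.P J) 0 (Matrix.specialUnitaryGroup (Fin 2) ℂ)) : ℝ :=
  lam * deriv (fun μ : ℝ => fluctAtCan F γ b₀ p₀ ε₀ hJK μ V) lam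

/-- `𝔣^λ/λ = ∂_λ f^λ` for `λ ≠ 0`. [cite: Michael1987ActionSumRules, (2.3)] -/
theorem flowCan_div {lam : ℝ} (hlam : lam ≠ 0) (V : GaugeField (F.P J) 0 (Matrix.specialUnitaryGroup (Fin 2) ℂ)) :
    flowCan F γ b₀ p₀ ε₀ hJK lam V / lam = deriv (fun μ : ℝ => fluctAtCan F γ b₀ p₀ ε₀ hJK μ V) lam := by
  unfold flowCan; field_simp

/-- DIFF at a point ⇒ `f^·(V)` has derivative `𝔣^λ(V)/λ` at `λ ≠ 0`. [cite: Michael1987ActionSumRules, (2.3)] -/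
theorem hasDerivAt_fluctAtCan {lam : ℝ} (hlam : lam ≠ 0) {V : GaugeField (F.P J) 0 (Matrix.specialUnitaryGroup (Fin 2) ℂ)}
    (h : DifferentiableAt ℝ (fun μ : ℝ => fluctAtCan F γ b₀ p₀ ε₀ hJK μ V) lam) :
    HasDerivAt (fun μ : ℝ => fluctAtCan F γ b₀ p₀ ε₀ hJK μ V) (flowCan F γ b₀ p₀ ε₀ hJK lam V / lam) lam := by
  rw [flowCan_div F γ b₀ p₀ ε₀ hJK hlam]
  exact h.hasDerivAt

/-- **THE 4-POINT OF `f^λ` HAS DERIVATIVE `fourPt(𝔣^λ)/λ`** at every `λ ≠ 0` where the four corner functions are differentiable (linearity of `deriv`).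
[cite: Michael1987ActionSumRules, (2.3); Balaban1985UV3, (41) p.266] -/
theorem hasDerivAt_fourPt_fluctAtCan {lam : ℝ} (hlam : lam ≠ 0) (U V W Z : GaugeField (F.P J) 0 (Matrix.specialUnitaryGroup (Fin 2) ℂ))
    (hU : DifferentiableAt ℝ (fun μ : ℝ => fluctAtCan F γ b₀ p₀ ε₀ hJK μ U) lam)
    (hV : DifferentiableAt ℝ (fun μ : ℝ => fluctAtCan F γ b₀ p₀ ε₀ hJK μ V) lam)
    (hW : DifferentiableAt ℝ (fun μ : ℝ => fluctAtCan F γ b₀ p₀ ε₀ hJK μ W) lam)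
    (hZ : DifferentiableAt ℝ (fun μ : ℝ => fluctAtCan F γ b₀ p₀ ε₀ hJK μ Z) lam) :
    HasDerivAt (fun μ : ℝ => fourPt (fluctAtCan F γ b₀ p₀ ε₀ hJK μ) U V W Z)
      (fourPt (fun X => flowCan F γ b₀ p₀ ε₀ hJK lam X) U V W Z / lam) lam := by
  have h := ((hasDerivAt_fluctAtCan F γ b₀ p₀ ε₀ hJK hlam hU).sub (hasDerivAt_fluctAtCan F γ b₀ p₀ ε₀ hJK hlam hV)).sub
    ((hasDerivAt_fluctAtCan F γ b₀ p₀ ε₀ hJK hlam hW).sub (hasDerivAt_fluctAtCan F γ b₀ p₀ ε₀ hJK hlam hZ))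
  refine (h.congr_deriv ?_)
  unfold fourPt; field_simp

/-- The flow 4-point divided by `λ` is a MEASURABLE function of `λ` (derivatives are measurable, `measurable_deriv`). [cite: Michael1987ActionSumRules, (2.3)] -/
theorem measurable_fourPt_flowCan_div (U V W Z : GaugeField (F.P J) 0 (Matrix.specialUnitaryGroup (Fin 2) ℂ)) :
    Measurable (fun lam : ℝ => fourPt (fun X => flowCan F γ b₀ p₀ ε₀ hJK lam X) U V W Z / lam) := by
  unfold fourPt flowCan
  have hd : ∀ X : GaugeField (F.P J) 0 (Matrix.specialUnitaryGroup (Fin 2) ℂ),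
      Measurable (fun lam : ℝ => lam * deriv (fun μ : ℝ => fluctAtCan F γ b₀ p₀ ε₀ hJK μ X) lam) :=
    fun X => measurable_id.mul (measurable_deriv _)
  exact (((hd U).sub (hd V)).sub ((hd W).sub (hd Z))).div measurable_id

end Flow

/-! ## §2 THE TABLE: DIFF (stub, S/M, hand-ready) and the ORGAN FMIX (stub, XL) -/

section Organ

/-- **DIFF · λ-DIFFERENTIABILITY OF THE SCALED FLUCTUATION PART ON THE WINDOW (stub; S/M; hand-ready for the LAPLACE/WREG pens)**: in the regime of the package
(same prefix as SCL of LINE g19-2), for every run `K`, height `J ≤ K`, window point `V` and `λ ≥ 1`, `μ ↦ f^μ(V)` is differentiable at `λ`.  Route: on the window the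
canonical version at coupling `γ/μ` IS the explicit fibre integral `∫_{fibre(V)} 1_hist e^{−μβA} dμ_V / Z_μ` (the closed WREG table of LINE g18-2 `Lines/wreg_chart.lean`
v19 — continuous representative ⇒ `Node00.canonVersion_eqOn_of_continuousOn` — applied at coupling `γ/μ` on the FIXED `γ`-window, i.e. at the rescaled width
`b₀·√μ·p(g/√μ)^{p₀}/p(g)^{p₀}`), positive there, and `μ ↦ ∫ 1_hist e^{−μβA}` is differentiable by dominated differentiation on the compact fibre
(`hasDerivAt_integral_of_dominated_loc_of_deriv_le`); `μ ↦ β_K(γ/μ) = μ·β_K(γ)` is linear.  Why it might fail: the package's regime `ε₀ ≤ ε₁(b₀, p₀)` may pinch under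
the `b₀`-rescaling for large `μ`; the repair is NOT a truncated DIFF (see the header: `deriv`-junk makes FMIX vacuous off the differentiability set) but the
derivative-free oscillation form FMIX′ replacing DIFF ∧ FMIX jointly; DIFF stays on `[1, ∞)`.  N1 (critic #375): `DifferentiableAt` at `λ = 1` is TWO-SIDED, so couplings
`γ/μ` slightly ABOVE `γ` (`μ → 1⁻`) enter — absorbed by this statement's own `∃ γ₁` (take it at most half the package's), harmless.
[cite: Balaban1985UV3, (2) p.256 and (41) p.266; Michael1987ActionSumRules, (2.3)] -/
def FluctDifferentiableCan : Prop :=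
  ∀ (L : ℕ), ∃ pS : ℝ, ∀ (b₀ p₀ : ℝ), 0 < b₀ → pS ≤ p₀ → 0 < p₀ → ∃ ε₁ : ℝ, 0 < ε₁ ∧ ∀ (ε₀ : ℝ), 0 < ε₀ → ε₀ ≤ ε₁ →
    ∃ γ₁ : ℝ, 0 < γ₁ ∧ ∀ (F : T3Family) (γ : ℝ), F.L = L → 0 < γ → γ ≤ γ₁ →
      ∀ (J K : ℕ) (hJK : J ≤ K) (V : GaugeField (F.P J) 0 (Matrix.specialUnitaryGroup (Fin 2) ℂ)), PlaqSmall (θBal F.L γ b₀ p₀ J) V →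
        ∀ lam : ℝ, 1 ≤ lam → DifferentiableAt ℝ (fun μ : ℝ => fluctAtCan F γ b₀ p₀ ε₀ hJK μ V) lam

/-- **FMIX · THE FLOW'S CONNECTED 4-POINT IS κ-CLUSTERED WITH AN INTEGRABLE λ-TAIL (organ stub; XL; this line's)**.  H4ᶜ's prefix VERBATIM through `κ`, `F`, `γ`,
`Φ` (`Φ ≥ 0`, `J·Φ J → 0`), then a decay exponent `∃ η > 0`, and: for every run `K`, height `J ≤ K`, bonds `b, b′`, window quadruple `U, V, W, Z` under the four
one-bond moves of H4ᶜ, and every `λ ≥ 1`, `|fourPt(𝔣^λ)(U,V,W,Z)| ≤ Φ J · λ^{−η} · e^{−κ·tdist(b,b′)}`.  CONTENT (print's variables): `fourPt(𝔣^λ)` is the connected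
response of the constrained mean energy `⟨λβ(A − A_min)⟩_{V,λ}` to two datum-bond moves — after the fibre-translation change of variables, a sum of truncated 2- and
3-point functions `⟨∂_b S ; ∂_{b′} S⟩`, `⟨λβ(A−A_min) ; ∂_b S ; ∂_{b′} S⟩`, `⟨∂_b∂_{b′} S⟩ − (Gaussian value)` of LOCAL observables (one leg extensive) under the fluctuation
measure at coupling `γ/λ ≤ γ` in a unit-gap background (GAP♯'s regime): κ-clustering = tree-graph decay of truncated functions; the one-loop (Gaussian) term is ABSENT by
equipartition (`⟨λβQ⟩ = ½ rank`, datum-independent); the rest carries `g_λ² = γ/(λL^J)` — whence `λ^{−η}` (print: `η = 1`) AND `Φ J ~ γL^{−J}·p(g_J)^k` (so `J·Φ J → 0` with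
room); the sharp windows add `O(e^{−c p(g_J)²})`.  Tools: [Balaban1985UV3] §A (25)–(37) (expectations in the expanded one-step measure), (29)–(33) (localisation of
propagators and background dependence), [Balaban1987RG1] (0.13)–(0.26) (multi-step); tree: ✓(D1) `coercive_combes_thomas_real`, ✓`…LogDetMixedDifferenceLocallySummed`,
✓`…LocalPerturbationObservables`/`…ClusterExpansion*` at depth one with the Neumann finite-range pieces (`NeumannFRDSketch.lean`, hand w3-20520 g16).  WALL (honest; critic #375
P2's sentence): FMIX ⊇ H4ᶜ at EVERY base point λ₀ ≥ 1 AND 1L4ᶜ's clause (T) for window quadruples (`oneLoopFourPt_tendsto_of_flow`); its λ-uniform clustering is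
Bałaban's multi-step control of the constrained fluctuation measure at couplings γ/λ ≤ γ (REP's wall) PLUS the 4-point Laplace limit (LAPLACE/1L4ᶜ's wall) — both
counted once, here; removed are the identity form, the strict V-locality of activities and the one-loop subtraction, not the expansion.  N2 (consistency, one
sentence): `fluctAtCan`'s classical cancellation uses that `minActionRegPr … ε₀` IS the exact fibre minimum on the window (inherited verbatim from S2β v10.1's
definitions — EXW/WREG content, not new debt); FMIX's `λ^{−η}` is the first statement that detects a mismatch LINEARLY in λ (a residual classical term `λβ·δA_min(V)`
has non-zero `fourPt` growing like λ and violates FMIX at once) — pen check: at one loop `f^λ(V) = −(n_phys/2)·log λ + G(V) + const` has no term linear in λ iff the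
subtracted action is the fibre minimum.  Why it might fail: (i) at FIXED `λ` the bound is a clustering statement for a weakly
coupled unit-gap measure — standard; UNIFORMITY in `λ → ∞` needs the expansion's constants monotone in the coupling (they are: `γ/λ ≤ γ`) AND the `λ^{−η}` extraction, i.e.
that every term of `fourPt(𝔣^λ)` surviving equipartition has ≥ one vertex — a degenerate (non-Morse-Bott) direction of the constrained action on some fibre would leave
an `O(1)` non-Gaussian defect (GAP♯ says there is none); (ii) the measure's response to moving the fibre (datum bonds `b`, `b′`) must itself be local — EXW's chart rows /
`Node00.AveragingSkewPresentation` give the translation, its Jacobian is a local factor. [cite: Balaban1985UV3, (25)-(37) pp.262-265 and (41)-(47) pp.266-267; Balaban1987RG1, (0.13)-(0.26) pp.254-257; Michael1987ActionSumRules, (2.3)-(2.6)] -/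
def FlowFourPtDecayCan : Prop :=
  ∀ (L : ℕ), ∃ pS : ℝ, ∀ (b₀ p₀ : ℝ), 0 < b₀ → pS ≤ p₀ → 0 < p₀ → ∃ ε₁ : ℝ, 0 < ε₁ ∧ ∀ (ε₀ : ℝ), 0 < ε₀ → ε₀ ≤ ε₁ →
    ∃ γ₁ : ℝ, 0 < γ₁ ∧ ∃ κ : ℝ, 0 < κ ∧ ∀ (F : T3Family) (γ : ℝ), F.L = L → 0 < γ → γ ≤ γ₁ →
      ∃ Φ : ℕ → ℝ, (∀ J, 0 ≤ Φ J) ∧ Tendsto (fun J : ℕ => (J : ℝ) * Φ J) atTop (𝓝 0) ∧ ∃ η : ℝ, 0 < η ∧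
        ∀ (J K : ℕ) (hJK : J ≤ K) (b b' : PBond (F.P J) 0) (U V W Z : GaugeField (F.P J) 0 (Matrix.specialUnitaryGroup (Fin 2) ℂ)),
          PlaqSmall (θBal F.L γ b₀ p₀ J) U → PlaqSmall (θBal F.L γ b₀ p₀ J) V →
          PlaqSmall (θBal F.L γ b₀ p₀ J) W → PlaqSmall (θBal F.L γ b₀ p₀ J) Z →
          (∀ e, e ≠ b → U e = V e) → (∀ e, e ≠ b' → U e = W e) → (∀ e, e ≠ b' → V e = Z e) → (∀ e, e ≠ b → W e = Z e) →
          ∀ lam : ℝ, 1 ≤ lam →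
            |fourPt (fun X => flowCan F γ b₀ p₀ ε₀ hJK lam X) U V W Z| ≤ Φ J * lam ^ (-η) * Real.exp (-(κ * (b.src.tdist b'.src : ℝ)))

/-- **FMIX₁ · THE FIRST RUNG (depth one, `K := J+1`; a def, NOT a stub)**: FMIX for ONE constrained fluctuation integral — the hands' entry signature (one unit-gap
near-Gaussian measure over the fibres of one averaging step; the tree's `LocalPerturbation*` engine + Neumann finite-range pieces apply).
[cite: Balaban1985UV3, (25)-(37) pp.262-265] -/
def FlowFourPtDecayDepthOneCan : Prop :=
  ∀ (L : ℕ), ∃ pS : ℝ, ∀ (b₀ p₀ : ℝ), 0 < b₀ → pS ≤ p₀ → 0 < p₀ → ∃ ε₁ : ℝ, 0 < ε₁ ∧ ∀ (ε₀ : ℝ), 0 < ε₀ → ε₀ ≤ ε₁ →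
    ∃ γ₁ : ℝ, 0 < γ₁ ∧ ∃ κ : ℝ, 0 < κ ∧ ∀ (F : T3Family) (γ : ℝ), F.L = L → 0 < γ → γ ≤ γ₁ →
      ∃ Φ : ℕ → ℝ, (∀ J, 0 ≤ Φ J) ∧ Tendsto (fun J : ℕ => (J : ℝ) * Φ J) atTop (𝓝 0) ∧ ∃ η : ℝ, 0 < η ∧
        ∀ (J : ℕ) (b b' : PBond (F.P J) 0) (U V W Z : GaugeField (F.P J) 0 (Matrix.specialUnitaryGroup (Fin 2) ℂ)),
          PlaqSmall (θBal F.L γ b₀ p₀ J) U → PlaqSmall (θBal F.L γ b₀ p₀ J) V →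
          PlaqSmall (θBal F.L γ b₀ p₀ J) W → PlaqSmall (θBal F.L γ b₀ p₀ J) Z →
          (∀ e, e ≠ b → U e = V e) → (∀ e, e ≠ b' → U e = W e) → (∀ e, e ≠ b' → V e = Z e) → (∀ e, e ≠ b → W e = Z e) →
          ∀ lam : ℝ, 1 ≤ lam →
            |fourPt (fun X => flowCan F γ b₀ p₀ ε₀ (Nat.le_succ J) lam X) U V W Z| ≤ Φ J * lam ^ (-η) * Real.exp (-(κ * (b.src.tdist b'.src : ℝ)))

/-- **FMIX ⇒ FMIX₁ (PROVED)**: specialise to `K := J + 1`. [cite: Balaban1985UV3, (25)-(37) pp.262-265] -/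
theorem flowFourPtDecayDepthOne_of_flow (h : FlowFourPtDecayCan) : FlowFourPtDecayDepthOneCan := by
  intro L
  obtain ⟨pS, H⟩ := h L
  refine ⟨pS, fun b₀ p₀ hb hp hp0 => ?_⟩
  obtain ⟨ε₁, hε₁, H1⟩ := H b₀ p₀ hb hp hp0
  refine ⟨ε₁, hε₁, fun ε₀ hε₀ hε₀le => ?_⟩
  obtain ⟨γ₁, hγ₁, κ, hκ, H2⟩ := H1 ε₀ hε₀ hε₀le
  refine ⟨γ₁, hγ₁, κ, hκ, fun F γ hFL hγ hγle => ?_⟩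
  obtain ⟨Φ, hΦ0, hΦ, η, hη, H3⟩ := H2 F γ hFL hγ hγle
  exact ⟨Φ, hΦ0, hΦ, η, hη, fun J => H3 J (J + 1) (Nat.le_succ J)⟩

end Organ

/-! ## §3 THE PROVED REDUCTION: DIFF ∧ FMIX ⇒ H4ᶜ (the one-loop part is the boundary term at `λ = ∞`; `∫_1^∞ λ^{−1−η} dλ = 1/η`) -/

section Reduction

/-- `∫_1^∞ λ^{−(η+1)} dλ = 1/η` for `η > 0`. [cite: Michael1987ActionSumRules, (2.3)] -/
theorem integral_Ioi_one_rpow_neg (η : ℝ) (hη : 0 < η) : ∫ t : ℝ in Ioi 1, t ^ (-(η + 1)) = 1 / η := by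
  rw [integral_Ioi_rpow_of_lt (by linarith : (-(η + 1) : ℝ) < -1) one_pos, Real.one_rpow]
  have hne : (-(η + 1) + 1 : ℝ) ≠ 0 := by intro h; linarith
  field_simp
  ring

/-- **THE CORE ESTIMATE (PROVED)**: if `g` has derivative `g′` on `[1,∞)` with `|g′ λ| ≤ M·λ^{−(η+1)}` and `g′` measurable, then `g` converges at `∞` and
`|g 1 − lim g| ≤ M/η` — FTC on `[1, ∞)` (`integral_Ioi_of_hasDerivAt_of_tendsto'`) with the limit's EXISTENCE from the integrable derivative
(`tendsto_limUnder_of_hasDerivAt_of_integrableOn_Ioi`). [cite: Michael1987ActionSumRules, (2.3)] -/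
theorem abs_sub_limUnder_le_of_deriv_bound {g g' : ℝ → ℝ} {M η : ℝ} (hη : 0 < η)
    (hderiv : ∀ x ∈ Ici (1 : ℝ), HasDerivAt g (g' x) x) (hmeas : Measurable g')
    (hbound : ∀ x : ℝ, 1 ≤ x → |g' x| ≤ M * x ^ (-(η + 1))) :
    Tendsto g atTop (𝓝 (limUnder atTop g)) ∧ |g 1 - limUnder atTop g| ≤ M / η := by
  have hG : IntegrableOn (fun x : ℝ => M * x ^ (-(η + 1))) (Ioi 1) :=
    (integrableOn_Ioi_rpow_of_lt (by linarith : (-(η + 1) : ℝ) < -1) one_pos).const_mul M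
  have hae : ∀ᵐ x ∂(volume.restrict (Ioi (1 : ℝ))), ‖g' x‖ ≤ M * x ^ (-(η + 1)) := by
    rw [ae_restrict_iff' measurableSet_Ioi]
    exact Eventually.of_forall fun x hx => by
      rw [Real.norm_eq_abs]; exact hbound x (le_of_lt hx)
  have hint : IntegrableOn g' (Ioi 1) := Integrable.mono' hG hmeas.aestronglyMeasurable hae
  have hlim : Tendsto g atTop (𝓝 (limUnder atTop g)) :=
    tendsto_limUnder_of_hasDerivAt_of_integrableOn_Ioi (fun x hx => hderiv x (Set.mem_Ici.mpr (le_of_lt hx))) hint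
  refine ⟨hlim, ?_⟩
  have hftc : ∫ x in Ioi 1, g' x = limUnder atTop g - g 1 := integral_Ioi_of_hasDerivAt_of_tendsto' hderiv hint hlim
  have hnorm : ‖∫ x in Ioi 1, g' x‖ ≤ ∫ x in Ioi 1, M * x ^ (-(η + 1)) := norm_integral_le_of_norm_le hG hae
  rw [integral_const_mul, integral_Ioi_one_rpow_neg η hη, hftc, Real.norm_eq_abs] at hnorm
  rw [abs_sub_comm]
  calc |limUnder atTop g - g 1| ≤ M * (1 / η) := hnorm
    _ = M / η := by ring

/-- **DIFF ∧ FMIX ⇒ H4ᶜ (PROVED).**  For a window quadruple, `g(λ) := fourPt f^λ` has derivative `fourPt(𝔣^λ)/λ` (DIFF, `hasDerivAt_fourPt_fluctAtCan`), bounded by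
`Φ J e^{−κd}·λ^{−(η+1)}` (FMIX); the core estimate gives the EXISTENCE of `Λ₄ = lim g` (H4ᶜ's `oneLoopFourPtCan` is that `limUnder` by definition) and
`|fourPt f¹ − Λ₄| ≤ (Φ J/η)·e^{−κd}`: H4ᶜ with `φ₂ J := Φ J/η` (thresholds merged by `max`/`min`). [cite: Balaban1985UV3, (45)-(47) p.267; Michael1987ActionSumRules, (2.3)] -/
theorem beyondOneLoopSmallCan_of_flow (hD : FluctDifferentiableCan) (hM : FlowFourPtDecayCan) : BeyondOneLoopSmallCan := by
  intro L
  obtain ⟨pS₁, hpS₁⟩ := hD L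
  obtain ⟨pS₂, hpS₂⟩ := hM L
  refine ⟨max pS₁ pS₂, fun b₀ p₀ hb₀ hp hp₀ => ?_⟩
  obtain ⟨ε₁, hε₁, hε⟩ := hpS₁ b₀ p₀ hb₀ ((le_max_left _ _).trans hp) hp₀
  obtain ⟨ε₂, hε₂, hε'⟩ := hpS₂ b₀ p₀ hb₀ ((le_max_right _ _).trans hp) hp₀
  refine ⟨min ε₁ ε₂, lt_min hε₁ hε₂, fun ε₀ hε₀ hε₀₁ => ?_⟩
  obtain ⟨γ₁, hγ₁, hFam₁⟩ := hε ε₀ hε₀ (hε₀₁.trans (min_le_left _ _))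
  obtain ⟨γ₂, hγ₂, κ, hκ, hFam₂⟩ := hε' ε₀ hε₀ (hε₀₁.trans (min_le_right _ _))
  refine ⟨min γ₁ γ₂, lt_min hγ₁ hγ₂, κ, hκ, fun F γ hFL hγ hγle => ?_⟩
  have hD₁ := hFam₁ F γ hFL hγ (hγle.trans (min_le_left _ _))
  obtain ⟨Φ, hΦ0, hΦlim, η, hη, hrun⟩ := hFam₂ F γ hFL hγ (hγle.trans (min_le_right _ _))
  refine ⟨fun J => Φ J / η, fun J => div_nonneg (hΦ0 J) hη.le, ?_, ?_⟩
  · have : Tendsto (fun J : ℕ => (1 / η) * ((J : ℝ) * Φ J)) atTop (𝓝 ((1 / η) * 0)) := hΦlim.const_mul _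
    rw [mul_zero] at this
    refine this.congr' (Eventually.of_forall fun J => ?_)
    show (1 / η) * ((J : ℝ) * Φ J) = (J : ℝ) * (Φ J / η)
    ring
  · intro J K hJK b b' U V W Z hU hV hW hZ hUV hUW hVZ hWZ
    set d : ℝ := (b.src.tdist b'.src : ℝ) with hd
    -- the λ-family of 4-points and its derivative
    set g : ℝ → ℝ := fun μ => fourPt (fluctAtCan F γ b₀ p₀ ε₀ hJK μ) U V W Z with hg
    set g' : ℝ → ℝ := fun μ => fourPt (fun X => flowCan F γ b₀ p₀ ε₀ hJK μ X) U V W Z / μ with hg'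
    have hderiv : ∀ x ∈ Ici (1 : ℝ), HasDerivAt g (g' x) x := by
      intro x hx
      have hx1 : (1 : ℝ) ≤ x := hx
      have hx0 : x ≠ 0 := by intro h; rw [h] at hx1; linarith
      exact hasDerivAt_fourPt_fluctAtCan F γ b₀ p₀ ε₀ hJK hx0 U V W Z (hD₁ J K hJK U hU x hx1) (hD₁ J K hJK V hV x hx1)
        (hD₁ J K hJK W hW x hx1) (hD₁ J K hJK Z hZ x hx1)
    have hmeas : Measurable g' := measurable_fourPt_flowCan_div F γ b₀ p₀ ε₀ hJK U V W Z
    have hbound : ∀ x : ℝ, 1 ≤ x → |g' x| ≤ (Φ J * Real.exp (-(κ * d))) * x ^ (-(η + 1)) := by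
      intro x hx1
      have hx0 : 0 < x := by linarith
      have h4 := hrun J K hJK b b' U V W Z hU hV hW hZ hUV hUW hVZ hWZ x hx1
      have hsplit : x ^ (-(η + 1)) = x ^ (-η) * x⁻¹ := by
        rw [show (-(η + 1) : ℝ) = -η + (-1) by ring, Real.rpow_add hx0, Real.rpow_neg_one]
      rw [hg', abs_div, abs_of_pos hx0, div_eq_mul_inv, hsplit]
      calc |fourPt (fun X => flowCan F γ b₀ p₀ ε₀ hJK x X) U V W Z| * x⁻¹
          ≤ (Φ J * x ^ (-η) * Real.exp (-(κ * d))) * x⁻¹ :=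
            mul_le_mul_of_nonneg_right h4 (inv_nonneg.mpr hx0.le)
        _ = Φ J * Real.exp (-(κ * d)) * (x ^ (-η) * x⁻¹) := by ring
    have hcore := abs_sub_limUnder_le_of_deriv_bound hη hderiv hmeas hbound
    have hlim : limUnder atTop g = oneLoopFourPtCan F γ b₀ p₀ ε₀ hJK U V W Z := rfl
    have h1 : g 1 = fourPt (fluctAtCan F γ b₀ p₀ ε₀ hJK 1) U V W Z := rfl
    rw [← h1, ← hlim]
    calc |g 1 - limUnder atTop g| ≤ Φ J * Real.exp (-(κ * d)) / η := hcore.2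
      _ = Φ J / η * Real.exp (-(κ * d)) := by ring

/-- **FMIX ∧ DIFF ⇒ THE ONE-LOOP 4-POINT LIMIT EXISTS on window quadruples (PROVED corollary)** — 1L4ᶜ's clause (T), carried inside DIFF ∧ FMIX (not «for free»: the
Laplace limit is part of FMIX's λ-uniform content): an integrable λ-derivative forces `fourPt f^λ → Λ₄`. [cite: Balaban1985Variational, Thm 1 (8) p.279; Michael1987ActionSumRules, (2.3)] -/
theorem oneLoopFourPt_tendsto_of_flow (hD : FluctDifferentiableCan) (hM : FlowFourPtDecayCan) :
    ∀ (L : ℕ), ∃ pS : ℝ, ∀ (b₀ p₀ : ℝ), 0 < b₀ → pS ≤ p₀ → 0 < p₀ → ∃ ε₁ : ℝ, 0 < ε₁ ∧ ∀ (ε₀ : ℝ), 0 < ε₀ → ε₀ ≤ ε₁ →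
      ∃ γ₁ : ℝ, 0 < γ₁ ∧ ∀ (F : T3Family) (γ : ℝ), F.L = L → 0 < γ → γ ≤ γ₁ →
        ∀ (J K : ℕ) (hJK : J ≤ K) (b b' : PBond (F.P J) 0) (U V W Z : GaugeField (F.P J) 0 (Matrix.specialUnitaryGroup (Fin 2) ℂ)),
          PlaqSmall (θBal F.L γ b₀ p₀ J) U → PlaqSmall (θBal F.L γ b₀ p₀ J) V →
          PlaqSmall (θBal F.L γ b₀ p₀ J) W → PlaqSmall (θBal F.L γ b₀ p₀ J) Z →
          (∀ e, e ≠ b → U e = V e) → (∀ e, e ≠ b' → U e = W e) → (∀ e, e ≠ b' → V e = Z e) → (∀ e, e ≠ b → W e = Z e) →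
          Tendsto (fun lam : ℝ => fourPt (fluctAtCan F γ b₀ p₀ ε₀ hJK lam) U V W Z) atTop
            (𝓝 (oneLoopFourPtCan F γ b₀ p₀ ε₀ hJK U V W Z)) := by
  intro L
  obtain ⟨pS₁, hpS₁⟩ := hD L
  obtain ⟨pS₂, hpS₂⟩ := hM L
  refine ⟨max pS₁ pS₂, fun b₀ p₀ hb₀ hp hp₀ => ?_⟩
  obtain ⟨ε₁, hε₁, hε⟩ := hpS₁ b₀ p₀ hb₀ ((le_max_left _ _).trans hp) hp₀
  obtain ⟨ε₂, hε₂, hε'⟩ := hpS₂ b₀ p₀ hb₀ ((le_max_right _ _).trans hp) hp₀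
  refine ⟨min ε₁ ε₂, lt_min hε₁ hε₂, fun ε₀ hε₀ hε₀₁ => ?_⟩
  obtain ⟨γ₁, hγ₁, hFam₁⟩ := hε ε₀ hε₀ (hε₀₁.trans (min_le_left _ _))
  obtain ⟨γ₂, hγ₂, κ, hκ, hFam₂⟩ := hε' ε₀ hε₀ (hε₀₁.trans (min_le_right _ _))
  refine ⟨min γ₁ γ₂, lt_min hγ₁ hγ₂, fun F γ hFL hγ hγle => ?_⟩
  have hD₁ := hFam₁ F γ hFL hγ (hγle.trans (min_le_left _ _))
  obtain ⟨Φ, hΦ0, hΦlim, η, hη, hrun⟩ := hFam₂ F γ hFL hγ (hγle.trans (min_le_right _ _))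
  intro J K hJK b b' U V W Z hU hV hW hZ hUV hUW hVZ hWZ
  set d : ℝ := (b.src.tdist b'.src : ℝ) with hd
  set g : ℝ → ℝ := fun μ => fourPt (fluctAtCan F γ b₀ p₀ ε₀ hJK μ) U V W Z with hg
  set g' : ℝ → ℝ := fun μ => fourPt (fun X => flowCan F γ b₀ p₀ ε₀ hJK μ X) U V W Z / μ with hg'
  have hderiv : ∀ x ∈ Ici (1 : ℝ), HasDerivAt g (g' x) x := by
    intro x hx
    have hx1 : (1 : ℝ) ≤ x := hx
    have hx0 : x ≠ 0 := by intro h; rw [h] at hx1; linarith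
    exact hasDerivAt_fourPt_fluctAtCan F γ b₀ p₀ ε₀ hJK hx0 U V W Z (hD₁ J K hJK U hU x hx1) (hD₁ J K hJK V hV x hx1)
      (hD₁ J K hJK W hW x hx1) (hD₁ J K hJK Z hZ x hx1)
  have hmeas : Measurable g' := measurable_fourPt_flowCan_div F γ b₀ p₀ ε₀ hJK U V W Z
  have hbound : ∀ x : ℝ, 1 ≤ x → |g' x| ≤ (Φ J * Real.exp (-(κ * d))) * x ^ (-(η + 1)) := by
    intro x hx1
    have hx0 : 0 < x := by linarith
    have h4 := hrun J K hJK b b' U V W Z hU hV hW hZ hUV hUW hVZ hWZ x hx1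
    have hsplit : x ^ (-(η + 1)) = x ^ (-η) * x⁻¹ := by
      rw [show (-(η + 1) : ℝ) = -η + (-1) by ring, Real.rpow_add hx0, Real.rpow_neg_one]
    rw [hg', abs_div, abs_of_pos hx0, div_eq_mul_inv, hsplit]
    calc |fourPt (fun X => flowCan F γ b₀ p₀ ε₀ hJK x X) U V W Z| * x⁻¹
        ≤ (Φ J * x ^ (-η) * Real.exp (-(κ * d))) * x⁻¹ :=
          mul_le_mul_of_nonneg_right h4 (inv_nonneg.mpr hx0.le)
      _ = Φ J * Real.exp (-(κ * d)) * (x ^ (-η) * x⁻¹) := by ring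
  exact (abs_sub_limUnder_le_of_deriv_bound hη hderiv hmeas hbound).1

end Reduction

/-! ## §4 Registered stubs and the delivered theorem -/

section Stubs

/-- DIFF stub (S/M; hand-ready for the LAPLACE/WREG pens): λ-differentiability of the scaled fluctuation part on the window. [cite: Balaban1985UV3, (2) p.256 and (41) p.266] -/
theorem stub_fluctDifferentiableCan : FluctDifferentiableCan := by
  sorry

/-- FMIX stub — THIS LINE's organ (XL): the flow's connected 4-point is κ-clustered with an integrable λ-tail, depth-uniformly.  First rung: `FlowFourPtDecayDepthOneCan`
(`flowFourPtDecayDepthOne_of_flow`). [cite: Balaban1985UV3, (25)-(37) pp.262-265 and (41)-(47) pp.266-267; Balaban1987RG1, (0.13)-(0.26) pp.254-257] -/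
theorem stub_flowFourPtDecayCan : FlowFourPtDecayCan := by
  sorry

/-- **H4ᶜ DELIVERED BY NAME** from the stubs DIFF and FMIX. [cite: Balaban1985UV3, (45)-(47) p.267] -/
theorem beyondOneLoopSmallCan_of_stubs : BeyondOneLoopSmallCan :=
  beyondOneLoopSmallCan_of_flow stub_fluctDifferentiableCan stub_flowFourPtDecayCan

/-- Registration alias (`ledger skeleton check --crux-decl …VirialFlow.BeyondOneLoopSmallCan`): the organ H4ᶜ concluded BY NAME from the two stubs.  The crux of
record `UnitScaleTilt.FluctuationComparisonRegPrIntL` is NOT concluded in this file — H4ᶜ feeds S2β (LINE g18-1, with EXW, GAP♯, LAPLACE, LFR♯ᶜ) which feeds the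
package `Lines/runpair_organ.lean` (with S1a, 26243, S2α′, O1); no docking stub hides that chain here. [cite: Balaban1985UV3, (45)-(47) p.267] -/
theorem BeyondOneLoopSmallCan_proof : BeyondOneLoopSmallCan := beyondOneLoopSmallCan_of_stubs

end Stubs

end Summit.QuantumFields.YangMills.Cruxes.FluctuationComparisonRegPrIntL.RunPairOrgan.VirialFlow
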